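import Literature.NumberTheory.GaloisCohomology.Howard2004.TransportUnramified
import Literature.NumberTheory.EllipticCurves.SemilinearLocalCohomology
import Literature.NumberTheory.GaloisRepresentations.GaloisCohomologyScalarAction
import Literature.NumberTheory.GaloisRepresentations.ContinuousH1ResCocycle
import HarnessLib

/-!
# Howard 2004, §1.3/§1.5: the action of `τ` on `H¹(K, T̄)` — classes, involution, eigenclasses,
# localization (theorems only)

Topic `NumberTheory/GaloisCohomology/Howard2004`. THEOREMS ONLY: no definition, no named fact, no
instance, no notation, no `sorry`. Cell `pub/bsd-print-x9`, print leaf G87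
`Literature.NumberTheory.GaloisCohomology.Howard2004.thm161_dvrKolyvaginBound` (Howard Thm. 1.6.1);
seat `bsd-line-x10b-p1-w5` g7. This is CURRENCY for the residual steps of §1.5–§1.6 (Lemma 1.5.3
«parity», Prop. 1.5.5, Lemma 1.6.2 in class form, Lemma 1.6.4 Cases i/ii), all of which are
statements about the `τ`-eigenspaces `H¹_{𝓕}(K, T̄)^±`.

SOURCE. B. Howard, *The Heegner point Kolyvagin system*, Compositio Math. **140** (2004) =
arXiv:1202.6340: §1.3 «conjugation by `τ` induces an isomorphism `H^i(K_v̄, T) ≅ H^i(K_v, Tw(T))`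
where `v̄ = v^τ`» (p. 7 L44–48); H.5(a) «the action of `G_K` on `T̄` extends to an action of `G_ℚ` and
the action of `τ` splits `T̄ = T̄⁺ ⊕ T̄⁻`» (p. 7 L93–95); H.5(b) «the condition `𝓕` propagated to `T̄` is
stable under the action of `G_ℚ`» (p. 7 L96–97); §1.5 «If `M` is any `R/𝔪`-vector space on which `τ`
acts we denote by `M⁺` and `M⁻` the subspaces on which `τ` acts by `+1` and `-1`» (p. 9 L122–126),
Def. 1.5.2 «`ρ(n)^±` the `R/𝔪`-dimension of `𝓗̄(n)^±`».

THE ACTION. For Howard's `ConjugationDatum cd` (`g^τ = cd.conj g = cd.isLift.conjGalCMH g`) and the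
`G_ℚ`-structure `A : ResidualTau cd ρbar` on `T̄` (`θ = A.θ`, `θ ∘ ρ̄(g^τ) = ρ̄(g) ∘ θ`), the pair
`(g ↦ g^τ, θ)` is a compatible pair, i.e. `θ` is `τ`-SEMILINEAR in the sense of the tree's
`EllipticCurves.IsSemilinear` (`ResidualTau.isSemilinear`), and the action of `τ` on `H¹(K, T̄)` IS the
tree's generic semilinear action (`EllipticCurves/SemilinearLocalCohomology.lean`)
`τ_* := EllipticCurves.semilinearH cd.isLift A.θ.toAddMonoidHom A.isSemilinear 1`;
no new definition is introduced — every statement below is about that term.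

WHAT IS PROVED.
* §1 `semilinearH_oneCocycleClass` (`τ_* [φ] = [g ↦ θ(φ(g^τ))]`, the cocycle of
  `ResidualTau.exists_conjTwist_cocycle` of `TauEigencocycleFrobeniusProofs.lean`), **`semilinearH_semilinearH`** (`τ_* ∘ τ_* = id`, from
  `τ² = 1` on `K̄` and `θ² = 1`), `semilinearH_scalarMapH1` (`τ_*` commutes with the scalars `R`).
* §2 eigenclasses: `semilinearH_oneCocycleClass_of_forall_eq[_neg]` (a pointwise eigencocycle
  `φ(g^τ) = ±θ(φ g)` gives an eigenclass `τ_*[φ] = ±[φ]`), and conversely, for `2 ∈ R×` and `T̄`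
  `R`-linear, **`exists_eigencocycle_of_semilinearH_eq[_neg]`** (every eigenclass is represented by a
  pointwise eigencocycle — the bridge to the cocycle currency of `TauEigencocycle*Proofs`), and the
  class-level splitting `eq_add_of_semilinearH` (`c = c⁺ + c⁻`, `τ_* c^± = ±c^±`).
* §3 **`localization_semilinearH`**: at a finite place `v`,
  `loc_v (τ_* c) = θ_* (transport_v (loc_{σ v} c))` with Howard's `cd.transportH1` and `A.thetaH1`
  (the inner correction `δ_v` of the datum contributes a coboundary) — the H.5(b) shape; hence
  **`semilinearH_mem_selmerGroup`**: the Selmer group of a structure whose local conditions satisfy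
  the H.5(b) containment at the finite places (and are full at the infinite places) is `τ`-stable, and
  `localization_semilinearH_eq_zero_iff` (`loc_v (τ_* c) = 0 ↔ loc_{σ v} c = 0`).

NOT HERE: eigenspace DIMENSIONS `ρ(n)^±` (they need the `R/𝔪`-module structure `moduleH1` and live
with Lemma 1.5.3), the local `τ`-action at an inert place as an endomorphism, global duality, anything
about `thm161_dvrKolyvaginBound` itself — NOT proved; no summit statement is proved; the
Birch–Swinnerton-Dyer conjecture is not proved by any of this.
References: [Howard2004HeegnerKolyvagin] §1.3 (H.5), §1.5 (Def. 1.5.2), Lemma 1.6.2;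
[SerreGaloisCohomology1997] I §2.4 (compatible pairs), I §5.1; [SerreLocalFields1979] VII §5 Prop. 3
(inner automorphisms act trivially on cohomology); [NeukirchSchmidtWingberg2008] I §5.
-/

set_option autoImplicit false

noncomputable section

open Function NumberField IsDedekindDomain Field
open scoped NumberField

namespace Literature.NumberTheory.GaloisCohomology.Howard2004

open Literature.NumberTheory.GaloisRepresentations
open Literature.NumberTheory.GaloisRepresentations.DiscreteGaloisModule
open Literature.NumberTheory.EllipticCurves

variable {K : Type} [Field K] [NumberField K] {Nbar : Type} [AddCommGroup Nbar]
  [TopologicalSpace Nbar] [DiscreteTopology Nbar] {R : Type} [CommRing R] [Module R Nbar]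
  {cd : ConjugationDatum K} {ρbar : DiscreteGaloisModule K Nbar}

/-- Conjugation by the involutive lift `τ` is an involution of `Γ_K`: `(g^τ)^τ = g` (cf. the tree's
`IsLiftOfAut.conjGalCMH_conjGalCMH`, reproved here to keep the import closure small). [folklore] -/
private theorem conj_conj (cd : ConjugationDatum K) (g : absoluteGaloisGroup K) :
    cd.conj (cd.conj g) = g := by
  have hinv : ∀ x, cd.τ (cd.τ x) = x := cd.involutive
  have hsymm : ∀ y, cd.τ.symm y = cd.τ y := fun y => by
    apply cd.τ.injective; rw [RingEquiv.apply_symm_apply, hinv]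
  apply AlgEquiv.ext
  intro x
  change cd.τ.symm (cd.τ.symm ((show AlgebraicClosure K ≃ₐ[K] AlgebraicClosure K from g)
    (cd.τ (cd.τ x)))) = (show AlgebraicClosure K ≃ₐ[K] AlgebraicClosure K from g) x
  rw [hinv, hsymm, hsymm, hinv]

namespace ResidualTau

/-! ## §1 The action of `τ` on `H¹(K, T̄)`: cocycles, involution, scalars -/

/-- **`θ` is `τ`-semilinear**: Howard's compatibility `θ ∘ ρ̄(g^τ) = ρ̄(g) ∘ θ` (H.5(a)) is the tree's
`IsSemilinear ρ̄ τ θ`, so `(g ↦ g^τ, θ)` is a compatible pair and `EllipticCurves.semilinearH` applies.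
[cite: Howard2004HeegnerKolyvagin, §1.3 H.5(a) (arXiv p. 7 L93–95)] [cite: SerreGaloisCohomology1997, I §2.4 (compatible pairs)] -/
theorem isSemilinear (A : ResidualTau (R := R) cd ρbar) :
    IsSemilinear ρbar cd.isLift A.θ.toAddMonoidHom := fun g x => A.compat g x

/-- **`τ_* [φ] = [g ↦ θ(φ(g^τ))]`**: the action on the class of a continuous crossed homomorphism is
the class of its `τ`-twist (the cocycle of `ResidualTau.exists_conjTwist_cocycle` of
`TauEigencocycleFrobeniusProofs`; here any `ψ` with that pointwise formula).
[cite: Howard2004HeegnerKolyvagin, §1.5 preamble (arXiv p. 9 L122–126)] [cite: SerreGaloisCohomology1997, I §5.1] -/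
theorem semilinearH_oneCocycleClass (A : ResidualTau (R := R) cd ρbar)
    (φ ψ : contOneCocycles ρbar.toTopRep) (hψ : ∀ g, ψ.1 g = A.θ (φ.1 (cd.conj g))) :
    semilinearH cd.isLift A.θ.toAddMonoidHom A.isSemilinear 1 (oneCocycleClass _ φ) =
      oneCocycleClass _ ψ := by
  have h : semilinearH cd.isLift A.θ.toAddMonoidHom A.isSemilinear 1 (oneCocycleClass _ φ) =
      oneCocycleClass _ (contOneCocycles.pullback cd.isLift.conjGalCMH
        (semilinearHom cd.isLift A.θ.toAddMonoidHom A.isSemilinear) φ) :=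
    map_oneCocycleClass _ _ _ φ
  rw [h]
  congr 1
  exact Subtype.ext (ContinuousMap.ext fun g => (hψ g).symm)

/-- **`τ_*` is an involution of `H¹(K, T̄)`**: `τ_* (τ_* c) = c`, because `τ` is an involution of `K̄`
(`(g^τ)^τ = g`) and `θ² = 1`. [cite: Howard2004HeegnerKolyvagin, §1.3 H.5(a) and §1.5 preamble (arXiv p. 7 L93–95; p. 9 L122–126)] [cite: SerreLocalFields1979, VII §5 Prop. 3] -/
theorem semilinearH_semilinearH (A : ResidualTau (R := R) cd ρbar) (c : galoisCohomology ρbar 1) :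
    semilinearH cd.isLift A.θ.toAddMonoidHom A.isSemilinear 1
      (semilinearH cd.isLift A.θ.toAddMonoidHom A.isSemilinear 1 c) = c := by
  obtain ⟨φ, rfl⟩ := oneCocycleClass_surjective ρbar.toTopRep c
  let ψ : contOneCocycles ρbar.toTopRep := contOneCocycles.pullback cd.isLift.conjGalCMH
    (semilinearHom cd.isLift A.θ.toAddMonoidHom A.isSemilinear) φ
  have hψ : ∀ g, ψ.1 g = A.θ (φ.1 (cd.conj g)) := fun g => rfl
  rw [A.semilinearH_oneCocycleClass φ ψ hψ, A.semilinearH_oneCocycleClass ψ φ]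
  intro g
  rw [hψ, conj_conj, A.involutive]

/-- **`τ_*` commutes with the scalars**: `τ_* (r · c) = r · (τ_* c)` for the functorial action
`scalarMapH1` of `R` on `H¹(K, T̄)` (`θ` is `R`-linear). So `τ_*` is an `R`- (and `R/𝔪`-) linear
involution and `H¹(K, T̄) = H¹(K, T̄)⁺ ⊕ H¹(K, T̄)⁻` for `2 ∈ R×`.
[cite: Howard2004HeegnerKolyvagin, §1.5 preamble (arXiv p. 9 L122–126)] [cite: SerreGaloisCohomology1997, I §2.2] -/
theorem semilinearH_scalarMapH1 (A : ResidualTau (R := R) cd ρbar) (hlin : ρbar.IsScalarLinear R)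
    (r : R) (c : galoisCohomology ρbar 1) :
    semilinearH cd.isLift A.θ.toAddMonoidHom A.isSemilinear 1
        (galoisCohomology.scalarMapH1 ρbar hlin r c) =
      galoisCohomology.scalarMapH1 ρbar hlin r
        (semilinearH cd.isLift A.θ.toAddMonoidHom A.isSemilinear 1 c) := by
  obtain ⟨φ, rfl⟩ := oneCocycleClass_surjective ρbar.toTopRep c
  let ψ : contOneCocycles ρbar.toTopRep := contOneCocycles.pullback cd.isLift.conjGalCMH
    (semilinearHom cd.isLift A.θ.toAddMonoidHom A.isSemilinear) φ
  have hψ : ∀ g, ψ.1 g = A.θ (φ.1 (cd.conj g)) := fun g => rfl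
  rw [galoisCohomology.scalarMapH1_oneCocycleClass, A.semilinearH_oneCocycleClass φ ψ hψ,
    galoisCohomology.scalarMapH1_oneCocycleClass,
    A.semilinearH_oneCocycleClass _ (galoisCohomology.scalarCocycle ρbar hlin r ψ)]
  intro g
  rw [galoisCohomology.scalarCocycle_apply, galoisCohomology.scalarCocycle_apply, hψ, map_smul]

/-! ## §2 Eigenclasses -/

/-- A pointwise `(+)`-eigencocycle, `φ(g^τ) = θ(φ g)`, has a `τ`-FIXED class: `τ_* [φ] = [φ]`.
[cite: Howard2004HeegnerKolyvagin, §1.5 preamble and Lemma 1.6.2 (arXiv p. 9 L122–126; p. 11 L30–31: «`c⁺ ∈ H¹(K, T̄)⁺`»)] -/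
theorem semilinearH_oneCocycleClass_of_forall_eq (A : ResidualTau (R := R) cd ρbar)
    (φ : contOneCocycles ρbar.toTopRep) (h : ∀ g, φ.1 (cd.conj g) = A.θ (φ.1 g)) :
    semilinearH cd.isLift A.θ.toAddMonoidHom A.isSemilinear 1 (oneCocycleClass _ φ) =
      oneCocycleClass _ φ :=
  A.semilinearH_oneCocycleClass φ φ fun g => by rw [h, A.involutive]

/-- A pointwise `(−)`-eigencocycle, `φ(g^τ) = -θ(φ g)`, has a `τ`-ANTI-fixed class: `τ_* [φ] = -[φ]`.
[cite: Howard2004HeegnerKolyvagin, §1.5 preamble and Lemma 1.6.2 (arXiv p. 9 L122–126; p. 11 L30–31: «`c⁻ ∈ H¹(K, T̄)⁻`»)] -/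
theorem semilinearH_oneCocycleClass_of_forall_eq_neg (A : ResidualTau (R := R) cd ρbar)
    (φ : contOneCocycles ρbar.toTopRep) (h : ∀ g, φ.1 (cd.conj g) = -A.θ (φ.1 g)) :
    semilinearH cd.isLift A.θ.toAddMonoidHom A.isSemilinear 1 (oneCocycleClass _ φ) =
      -oneCocycleClass _ φ := by
  have hneg : oneCocycleClass ρbar.toTopRep (-φ) = -oneCocycleClass ρbar.toTopRep φ := by
    rw [show (-φ) = 0 - φ from (zero_sub φ).symm, oneCocycleClass_sub, oneCocycleClass_zero,
      zero_sub]
  rw [← hneg]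
  exact A.semilinearH_oneCocycleClass φ (-φ) fun g => by
    change -(φ.1 g) = _
    rw [h, map_neg, A.involutive]

/-- **Every `τ`-fixed class is represented by a pointwise `(+)`-eigencocycle** (`2 ∈ R×`, `T̄`
`R`-linear): if `τ_* c = c` then `c = [φ]` with `φ(g^τ) = θ(φ g)` for ALL `g ∈ Γ_K` — namely
`φ = ½(φ₀ + τφ₀)` for any representative `φ₀`. This is the bridge from the eigenSPACES of §1.5 to the
eigenCOCYCLES consumed by Lemma 1.6.2 (`TauEigencocycleNonvanishingProofs`).
[cite: Howard2004HeegnerKolyvagin, Lemma 1.6.2 and Lemma 1.6.4 Case i (arXiv p. 11 L30–31; p. 12 L3–6: «This `d` has nontrivial projection onto one of the `τ`-eigencomponents»)] -/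
theorem exists_eigencocycle_of_semilinearH_eq (A : ResidualTau (R := R) cd ρbar)
    (hlin : ρbar.IsScalarLinear R) (htwo : IsUnit (2 : R)) (c : galoisCohomology ρbar 1)
    (hc : semilinearH cd.isLift A.θ.toAddMonoidHom A.isSemilinear 1 c = c) :
    ∃ φ : contOneCocycles ρbar.toTopRep, oneCocycleClass _ φ = c ∧
      ∀ g, φ.1 (cd.conj g) = A.θ (φ.1 g) := by
  obtain ⟨φ₀, rfl⟩ := oneCocycleClass_surjective ρbar.toTopRep c
  obtain ⟨u, hu⟩ := htwo
  let ψ : contOneCocycles ρbar.toTopRep := contOneCocycles.pullback cd.isLift.conjGalCMH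
    (semilinearHom cd.isLift A.θ.toAddMonoidHom A.isSemilinear) φ₀
  have hψ : ∀ g, ψ.1 g = A.θ (φ₀.1 (cd.conj g)) := fun g => rfl
  have hτ : semilinearH cd.isLift A.θ.toAddMonoidHom A.isSemilinear 1 (oneCocycleClass _ φ₀) =
      oneCocycleClass _ ψ := A.semilinearH_oneCocycleClass φ₀ ψ hψ
  refine ⟨galoisCohomology.scalarCocycle ρbar hlin ((u⁻¹ : Rˣ) : R) (φ₀ + ψ), ?_, fun g => ?_⟩
  · rw [← galoisCohomology.scalarMapH1_oneCocycleClass, oneCocycleClass_add, ← hτ, hc]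
    change galoisCohomology.scalarMapH1 ρbar hlin ((u⁻¹ : Rˣ) : R)
      ((oneCocycleClass ρbar.toTopRep φ₀ : galoisCohomology ρbar 1) +
        oneCocycleClass ρbar.toTopRep φ₀) = _
    have h2 : (oneCocycleClass ρbar.toTopRep φ₀ : galoisCohomology ρbar 1) +
          oneCocycleClass ρbar.toTopRep φ₀ =
        galoisCohomology.scalarMapH1 ρbar hlin (u : R) (oneCocycleClass ρbar.toTopRep φ₀) := by
      rw [hu, show (2 : R) = ((2 : ℤ) : R) by norm_num, galoisCohomology.scalarMapH1_intCast,
        two_zsmul]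
      rfl
    rw [h2, ← AddMonoidHom.comp_apply, ← galoisCohomology.scalarMapH1_mul, Units.inv_mul,
      galoisCohomology.scalarMapH1_one, AddMonoidHom.id_apply]
  · rw [galoisCohomology.scalarCocycle_apply, galoisCohomology.scalarCocycle_apply, map_smul]
    change ((u⁻¹ : Rˣ) : R) • (φ₀.1 (cd.conj g) + ψ.1 (cd.conj g)) =
      ((u⁻¹ : Rˣ) : R) • A.θ (φ₀.1 g + ψ.1 g)
    rw [hψ, hψ, conj_conj, map_add, A.involutive, add_comm]

/-- **Every `τ`-anti-fixed class is represented by a pointwise `(−)`-eigencocycle** (`2 ∈ R×`):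
`τ_* c = -c ⟹ c = [φ]` with `φ(g^τ) = -θ(φ g)` for all `g` (`φ = ½(φ₀ − τφ₀)`).
[cite: Howard2004HeegnerKolyvagin, Lemma 1.6.2 (arXiv p. 11 L30–31: «`c⁻ ∈ H¹(K, T̄)⁻`»)] -/
theorem exists_eigencocycle_of_semilinearH_eq_neg (A : ResidualTau (R := R) cd ρbar)
    (hlin : ρbar.IsScalarLinear R) (htwo : IsUnit (2 : R)) (c : galoisCohomology ρbar 1)
    (hc : semilinearH cd.isLift A.θ.toAddMonoidHom A.isSemilinear 1 c = -c) :
    ∃ φ : contOneCocycles ρbar.toTopRep, oneCocycleClass _ φ = c ∧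
      ∀ g, φ.1 (cd.conj g) = -A.θ (φ.1 g) := by
  obtain ⟨φ₀, rfl⟩ := oneCocycleClass_surjective ρbar.toTopRep c
  obtain ⟨u, hu⟩ := htwo
  let ψ : contOneCocycles ρbar.toTopRep := contOneCocycles.pullback cd.isLift.conjGalCMH
    (semilinearHom cd.isLift A.θ.toAddMonoidHom A.isSemilinear) φ₀
  have hψ : ∀ g, ψ.1 g = A.θ (φ₀.1 (cd.conj g)) := fun g => rfl
  have hτ : semilinearH cd.isLift A.θ.toAddMonoidHom A.isSemilinear 1 (oneCocycleClass _ φ₀) =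
      oneCocycleClass _ ψ := A.semilinearH_oneCocycleClass φ₀ ψ hψ
  refine ⟨galoisCohomology.scalarCocycle ρbar hlin ((u⁻¹ : Rˣ) : R) (φ₀ - ψ), ?_, fun g => ?_⟩
  · rw [← galoisCohomology.scalarMapH1_oneCocycleClass, oneCocycleClass_sub, ← hτ, hc]
    change galoisCohomology.scalarMapH1 ρbar hlin ((u⁻¹ : Rˣ) : R)
      ((oneCocycleClass ρbar.toTopRep φ₀ : galoisCohomology ρbar 1) -
        -(oneCocycleClass ρbar.toTopRep φ₀ : galoisCohomology ρbar 1)) = _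
    rw [sub_neg_eq_add]
    have h2 : (oneCocycleClass ρbar.toTopRep φ₀ : galoisCohomology ρbar 1) +
          oneCocycleClass ρbar.toTopRep φ₀ =
        galoisCohomology.scalarMapH1 ρbar hlin (u : R) (oneCocycleClass ρbar.toTopRep φ₀) := by
      rw [hu, show (2 : R) = ((2 : ℤ) : R) by norm_num, galoisCohomology.scalarMapH1_intCast,
        two_zsmul]
      rfl
    rw [h2, ← AddMonoidHom.comp_apply, ← galoisCohomology.scalarMapH1_mul, Units.inv_mul,
      galoisCohomology.scalarMapH1_one, AddMonoidHom.id_apply]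
  · rw [galoisCohomology.scalarCocycle_apply, galoisCohomology.scalarCocycle_apply, map_smul,
      ← smul_neg]
    change ((u⁻¹ : Rˣ) : R) • (φ₀.1 (cd.conj g) - ψ.1 (cd.conj g)) =
      ((u⁻¹ : Rˣ) : R) • -A.θ (φ₀.1 g - ψ.1 g)
    rw [hψ, hψ, conj_conj, map_sub, A.involutive, neg_sub]

/-- **Class-level eigen-splitting** `c = c⁺ + c⁻` (`2 ∈ R×`): with `u = 2⁻¹`, `c⁺ = u·(c + τ_* c)` is
`τ`-fixed and `c⁻ = u·(c − τ_* c)` is `τ`-anti-fixed — «`H¹(K, T̄) = H¹(K, T̄)⁺ ⊕ H¹(K, T̄)⁻`».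
[cite: Howard2004HeegnerKolyvagin, §1.5 preamble (arXiv p. 9 L122–126) and Lemma 1.6.4 Case i (p. 12 L3–6)] -/
theorem eq_add_of_semilinearH (A : ResidualTau (R := R) cd ρbar) (hlin : ρbar.IsScalarLinear R)
    (u : R) (hu : u * 2 = 1) (c : galoisCohomology ρbar 1) :
    c = galoisCohomology.scalarMapH1 ρbar hlin u
          (c + semilinearH cd.isLift A.θ.toAddMonoidHom A.isSemilinear 1 c) +
        galoisCohomology.scalarMapH1 ρbar hlin u
          (c - semilinearH cd.isLift A.θ.toAddMonoidHom A.isSemilinear 1 c) ∧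
      semilinearH cd.isLift A.θ.toAddMonoidHom A.isSemilinear 1
          (galoisCohomology.scalarMapH1 ρbar hlin u
            (c + semilinearH cd.isLift A.θ.toAddMonoidHom A.isSemilinear 1 c)) =
        galoisCohomology.scalarMapH1 ρbar hlin u
          (c + semilinearH cd.isLift A.θ.toAddMonoidHom A.isSemilinear 1 c) ∧
      semilinearH cd.isLift A.θ.toAddMonoidHom A.isSemilinear 1
          (galoisCohomology.scalarMapH1 ρbar hlin u
            (c - semilinearH cd.isLift A.θ.toAddMonoidHom A.isSemilinear 1 c)) =
        -galoisCohomology.scalarMapH1 ρbar hlin u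
          (c - semilinearH cd.isLift A.θ.toAddMonoidHom A.isSemilinear 1 c) := by
  refine ⟨?_, ?_, ?_⟩
  · rw [← map_add, add_add_sub_cancel]
    have h2 : c + c = galoisCohomology.scalarMapH1 ρbar hlin (2 : R) c := by
      rw [show (2 : R) = ((2 : ℤ) : R) by norm_num, galoisCohomology.scalarMapH1_intCast, two_zsmul]
    rw [h2, ← AddMonoidHom.comp_apply, ← galoisCohomology.scalarMapH1_mul, hu,
      galoisCohomology.scalarMapH1_one, AddMonoidHom.id_apply]
  · rw [A.semilinearH_scalarMapH1 hlin, map_add, A.semilinearH_semilinearH, add_comm]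
  · rw [A.semilinearH_scalarMapH1 hlin, map_sub, A.semilinearH_semilinearH, ← map_neg, neg_sub]

/-! ## §3 Localization: `loc_v ∘ τ_* = θ_* ∘ transport_v ∘ loc_{σ v}` (the H.5(b) shape) -/

/-- Two continuous crossed homomorphisms that differ by a coboundary have the same class.
[folklore] -/
private theorem oneCocycleClass_eq_of_forall_sub_eq {G : Type} [Group G] [TopologicalSpace G]
    [IsTopologicalGroup G] {Y : TopRep ℤ G} (a b : contOneCocycles Y) (m : Y)
    (h : ∀ g, a.1 g - b.1 g = Y.ρ g m - m) : oneCocycleClass Y a = oneCocycleClass Y b := by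
  rw [← sub_eq_zero, ← oneCocycleClass_sub, oneCocycleClass_eq_zero_iff]
  exact ⟨m, fun g => by rw [Submodule.coe_sub, ContinuousMap.sub_apply]; exact h g⟩

omit [NumberField K] in
/-- Cocycle identity `f(δ z δ⁻¹) = f(δ) + δ·f(z) − (δ z δ⁻¹)·f(δ)` for a crossed homomorphism `f`.
[folklore] -/
private theorem cocycle_apply_conj (f : contOneCocycles ρbar.toTopRep)
    (δ z : absoluteGaloisGroup K) :
    f.1 (δ * z * δ⁻¹) = f.1 δ + ρbar δ (f.1 z) - ρbar (δ * z * δ⁻¹) (f.1 δ) := by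
  have e1 : f.1 (δ * z * δ⁻¹ * δ) = f.1 (δ * z * δ⁻¹) + ρbar (δ * z * δ⁻¹) (f.1 δ) := by
    rw [(mem_contOneCocycles_iff f.1).mp f.2 (δ * z * δ⁻¹) δ, ContinuousRep.toTopRep_ρ_apply]
  have e2 : f.1 (δ * z * δ⁻¹ * δ) = f.1 δ + ρbar δ (f.1 z) := by
    rw [inv_mul_cancel_right, (mem_contOneCocycles_iff f.1).mp f.2 δ z,
      ContinuousRep.toTopRep_ρ_apply]
  rw [e2] at e1
  exact eq_sub_of_add_eq e1.symm

/-- **`loc_v (τ_* c) = θ_* (transport_v (loc_{σ v} c))`** at every finite place `v`: localizing the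
global action of `τ` at `v` is Howard's transport `H¹(K_{σ v}, T̄) → H¹(K_v, Tw T̄)` of the
localization at `σ v = v̄` followed by `θ : Tw(T̄) ≅ T̄` on `H¹(K_v, ·)` — the shape in which H.5(b) is
typed (`H5b`: `θ_* ∘ transport_v` carries `𝓕̄_{v̄}` onto `𝓕̄_v`). The inner correction `δ_v` of the
conjugation datum (`τ⁻¹ res_v(g) τ = δ_v res_{v̄}(φ_v g) δ_v⁻¹`) changes the cocycle by the coboundary
of `θ(f(δ_v))`. [cite: Howard2004HeegnerKolyvagin, §1.3 (arXiv p. 7 L44–48) and H.5(b) (p. 7 L96–97)] [cite: SerreLocalFields1979, VII §5 Prop. 3] -/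
theorem localization_semilinearH (A : ResidualTau (R := R) cd ρbar) (v : HeightOneSpectrum (𝓞 K))
    (c : galoisCohomology ρbar 1) :
    galoisCohomology.localization ρbar (Sum.inr v) 1
        (semilinearH cd.isLift A.θ.toAddMonoidHom A.isSemilinear 1 c) =
      A.thetaH1 (Sum.inr v) (cd.transportH1 ρbar v
        (galoisCohomology.localization ρbar (Sum.inr (cd.σ • v)) 1 c)) := by
  obtain ⟨f, rfl⟩ := oneCocycleClass_surjective ρbar.toTopRep c
  -- the global twist
  let ψ : contOneCocycles ρbar.toTopRep := contOneCocycles.pullback cd.isLift.conjGalCMH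
    (semilinearHom cd.isLift A.θ.toAddMonoidHom A.isSemilinear) f
  have hψ : ∀ g, ψ.1 g = A.θ (f.1 (cd.conj g)) := fun g => rfl
  rw [A.semilinearH_oneCocycleClass f ψ hψ]
  -- localizing a class: `loc_w [χ] = [χ ∘ res_w]` (Mathlib functoriality on cocycles)
  have hloc : ∀ (w : HeightOneSpectrum (𝓞 K)) (χ : contOneCocycles ρbar.toTopRep),
      galoisCohomology.localization ρbar (Sum.inr w) 1 (oneCocycleClass _ χ) =
        oneCocycleClass (ρbar.toLocal (Sum.inr w)).toTopRep
          (contOneCocycles.pullback (absGaloisRestrict K (Place.Completion (Sum.inr w)))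
            (X := ρbar.toTopRep) (Y := (ρbar.toLocal (Sum.inr w)).toTopRep)
            (TopRep.ofHom ⟨ContinuousLinearMap.id ℤ Nbar, fun _ => rfl⟩) χ) :=
    fun w χ => map_oneCocycleClass _ _ _ χ
  -- `θ_*` on a class: `θ_* [χ] = [θ ∘ χ]`
  have hθ : ∀ χ : contOneCocycles ((cd.twist ρbar).toLocal (Sum.inr v)).toTopRep,
      A.thetaH1 (Sum.inr v) (oneCocycleClass _ χ) = oneCocycleClass _
        (contOneCocycles.pullback (ContinuousMonoidHom.id _)
          (X := ((cd.twist ρbar).toLocal (Sum.inr v)).toTopRep)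
          (Y := (ρbar.toLocal (Sum.inr v)).toTopRep)
          (TopRep.ofHom ⟨⟨A.θ.toAddMonoidHom.toIntLinearMap, continuous_of_discreteTopology⟩,
            fun g => ContinuousLinearMap.ext fun x =>
              A.compat (absGaloisRestrict K (Place.Completion (Sum.inr v)) g) x⟩) χ) :=
    fun χ => map_oneCocycleClass _ _ _ χ
  rw [hloc, hloc, ConjugationDatum.transportH1_oneCocycleClass]
  refine Eq.trans ?_ (hθ _).symm
  refine oneCocycleClass_eq_of_forall_sub_eq _ _ (-(A.θ (f.1 (cd.δ v)))) fun g => ?_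
  change A.θ (f.1 (cd.conj (absGaloisRestrict K (v.adicCompletion K) g))) -
      A.θ (ρbar (cd.δ v) (f.1 (absGaloisRestrict K ((cd.σ • v).adicCompletion K) (cd.φ v g)))) =
    ρbar (absGaloisRestrict K (v.adicCompletion K) g) (-(A.θ (f.1 (cd.δ v)))) -
      -(A.θ (f.1 (cd.δ v)))
  rw [ConjugationDatum.conj_absGaloisRestrict_eq, cocycle_apply_conj,
    ← ConjugationDatum.conj_absGaloisRestrict_eq, map_sub, map_add, A.compat, map_neg]
  abel

/-- **`loc_v (τ_* c) = 0 ↔ loc_{σ v} c = 0`** (`θ_*` and the transport are injective: `θ² = 1` and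
`φ_v` is bijective with the inner correction a coboundary). At an inert `v = σ v` this is the
`τ`-equivariance of «`loc_v c = 0`», used in Lemma 1.6.4 Case i («`loc_ℓ(κ_n) = 0` contradicts
`loc_ℓ(d⁺) ≠ 0`»). [cite: Howard2004HeegnerKolyvagin, §1.3 (arXiv p. 7 L44–48) and Lemma 1.6.4 Case i (p. 12 L10–12)] -/
theorem localization_semilinearH_eq_zero_iff (A : ResidualTau (R := R) cd ρbar)
    (v : HeightOneSpectrum (𝓞 K)) (c : galoisCohomology ρbar 1)
    (hinj : Function.Injective ((A.thetaH1 (Sum.inr v)).comp (cd.transportH1 ρbar v))) :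
    galoisCohomology.localization ρbar (Sum.inr v) 1
        (semilinearH cd.isLift A.θ.toAddMonoidHom A.isSemilinear 1 c) = 0 ↔
      galoisCohomology.localization ρbar (Sum.inr (cd.σ • v)) 1 c = 0 := by
  rw [A.localization_semilinearH v c, ← AddMonoidHom.comp_apply]
  exact ⟨fun h => hinj (h.trans (map_zero _).symm), fun h => by rw [h, map_zero]⟩

/-- **The Selmer group of an H.5(b)-stable structure is `τ`-stable**: if at every finite place
`θ_* ∘ transport_v` maps `𝓕_{σ v}` into `𝓕_v` (Howard's H.5(b) for the propagated structure `𝓕̄`,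
which states equality) and the conditions at the infinite places are everything (automatic for `K`
imaginary quadratic, where `H¹(K_∞, ·) = 0`), then `c ∈ H¹_𝓕(K, T̄) ⟹ τ_* c ∈ H¹_𝓕(K, T̄)`: so `τ`
ACTS on `H¹_𝓕(K, T̄)` and `𝓗̄^± = H¹_𝓕(K, T̄)^±` make sense (Def. 1.5.2).
[cite: Howard2004HeegnerKolyvagin, H.5(b) and Def. 1.5.2 (arXiv p. 7 L96–97; p. 9 L133–135)] -/
theorem semilinearH_mem_selmerGroup (A : ResidualTau (R := R) cd ρbar) {𝓕 : SelmerStructure ρbar}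
    (h5b : ∀ v : HeightOneSpectrum (𝓞 K),
      (𝓕 (Sum.inr (cd.σ • v))).map ((A.thetaH1 (Sum.inr v)).comp (cd.transportH1 ρbar v)) ≤
        𝓕 (Sum.inr v))
    (hinf : ∀ (w : InfinitePlace K) (x : galoisCohomology (ρbar.toLocal (Sum.inl w)) 1),
      x ∈ 𝓕 (Sum.inl w))
    {c : galoisCohomology ρbar 1} (hc : c ∈ 𝓕.selmerGroup) :
    semilinearH cd.isLift A.θ.toAddMonoidHom A.isSemilinear 1 c ∈ 𝓕.selmerGroup := by
  rw [SelmerStructure.mem_selmerGroup_iff] at hc ⊢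
  rintro (w | v)
  · exact hinf w _
  · rw [A.localization_semilinearH v c]
    exact h5b v ⟨_, hc (Sum.inr (cd.σ • v)), rfl⟩

end ResidualTau

end Literature.NumberTheory.GaloisCohomology.Howard2004
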